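import Literature.AlgebraicGeometry.Resolution.WeightedCentreClassLinearPin
import HarnessLib

/-!
# THEOREM RZ, transport: a linear change of coordinates on the monomial-curve isotropy data
# (instrument for engine 1's `W(f)` toy model, NOT a resolution theorem)

Engine 1 of the RESOLUTION OBSERVATORY toy model `W(f)` (cell notes RE-DERIVATION-eng1-g41 §3.7.4 THEOREM RZ, case `C* = f`:
"So `Θ = kθ`, `P_{p,f} = θ ⊗ α(ε_Z)` … and (`e₁ := θ`) `F = c₁f₁^p + F′(f₂, …)` with `c₁ ≠ 0` (pin of `f₁`).  Now `(E_{p²})` …";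
CARVER-NOTES-eng1-g42 T92).  The words "(`e₁ := θ`)" are a change of the `f`-basis: the whole isotropy datum — the polynomial `g`, the
shift columns `P₁, P_p` and the isotropy equation `g(x + σP₁ + σ^pP_p) = g` — is transported along an invertible (class-)linear
substitution `A` with `A e_i = θ`, after which `WeightedCentreRZEndgame.eq_zero_of_isotropy` (second column concentrated in the slot `i`)
applies.  This file is that bookkeeping, in the data format of `WeightedCentreMonomialCurve` / `WeightedCentreRZEndgame` (a ring
endomorphism `Φ` of `(MvPolynomial ι K)[X]` fixing `K`, acting on the slots by `C (X j) ↦ C (X j) + Σ_t X^{e t} · C (v t j)`, fixing `C G`):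

* `RZTransport.substC A` — the coefficientwise substitution `F(x) ↦ F(Ax)` on `(MvPolynomial ι K)[X]`; `RZTransport.conj A A' Φ :=
  substC A ∘ Φ ∘ substC A'` — the conjugated endomorphism;
* `RZTransport.conj_C_C`, `conj_C_X`, `conj_C_linSubst` — for `A·A' = 1 = A'·A` the conjugate is again a datum of the same format, for the
  polynomial `G∘A := linSubst A G` and the columns `v' t j := Σ_k A'_{jk} · (v t k)∘A`;
* `RZTransport.column_eq_ite_of_rank_one` — if `v k = θ_k · α` with `α∘A = α` and `A e_i = θ`, the new column is `δ_{ji} · α`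
  (the format `hvi` of `RZEndgame.eq_zero_of_isotropy`);
* weights under CLASS-LINEAR `A` (class `S` on which the `ℕ`-valued `Z`-weight `zw` is constant): `exists_weight_eq_of_mem_support_linSubst`,
  `le_weight_of_mem_support_column` (the bounds `hv0/hv1` survive), `weightedHomogeneousComponent_linSubst` (`Ḡ∘A = (G∘A)‾`),
  `linSubst_eq_self_of_forall_notMem` (`Z`-forms are fixed);
* `RZTransport.eq_X_pow_mul_C_add` — the normal form `G = X_i^p · C c + R`, `deg_{X_i} R < p`, for `G` weighted homogeneous of weight
  `μ = p·w_i` with positive rational weights (the format `hG/hR` of `RZEndgame.eq_zero_of_isotropy`; pure weight count, no Frobenius).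

References: linear changes of coordinates and Taylor expansion [Lang2002, Ch. IV §1, Ch. XIII §4]; the weighted frame
[AbramovichTemkinWlodarczyk2024, §5.1 (p. 1575)].  All statements are OURS (toy-model bookkeeping; AI-written Lean, AI review is weaker
than expert review) — NOT statements about the invariant of [AbramovichTemkinWlodarczyk2024], NOT progress on the summit.
-/

namespace Literature.AlgebraicGeometry.Resolution.WeightedBlowup

namespace RZTransport

open MvPolynomial

variable {K : Type*} [Field K] {ι : Type*} [Fintype ι] [DecidableEq ι]

/-! ## The coefficientwise substitution and the conjugated endomorphism -/

/-- The coefficientwise linear substitution `F(x; X) ↦ F(Ax; X)` on `(MvPolynomial ι K)[X]` (ours, bookkeeping).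
[cite: Lang2002, Ch. IV §1] -/
noncomputable def substC (A : Matrix ι ι K) : Polynomial (MvPolynomial ι K) →+* Polynomial (MvPolynomial ι K) :=
  Polynomial.mapRingHom (InvariantDirection.linSubst fun j k => A j k : MvPolynomial ι K →ₐ[K] MvPolynomial ι K).toRingHom

omit [DecidableEq ι] in
/-- `substC A (C F) = C (F∘A)` (bookkeeping). [cite: Lang2002, Ch. IV §1] -/
@[simp] theorem substC_C (A : Matrix ι ι K) (F : MvPolynomial ι K) :
    substC A (Polynomial.C F) = Polynomial.C (InvariantDirection.linSubst (fun j k => A j k) F) := by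
  rw [substC, Polynomial.coe_mapRingHom, Polynomial.map_C]
  rfl

omit [DecidableEq ι] in
/-- `substC A X = X` (bookkeeping). [cite: Lang2002, Ch. IV §1] -/
@[simp] theorem substC_X (A : Matrix ι ι K) : substC A (Polynomial.X : Polynomial (MvPolynomial ι K)) = Polynomial.X := by
  rw [substC, Polynomial.coe_mapRingHom, Polynomial.map_X]

/-- The conjugated endomorphism `substC A ∘ Φ ∘ substC A'` (ours, bookkeeping): for `A' = A⁻¹` it is the isotropy datum in the
coordinates `x ↦ Ax`. [cite: Lang2002, Ch. IV §1] -/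
noncomputable def conj (A A' : Matrix ι ι K) (Φ : Polynomial (MvPolynomial ι K) →+* Polynomial (MvPolynomial ι K)) :
    Polynomial (MvPolynomial ι K) →+* Polynomial (MvPolynomial ι K) :=
  (substC A).comp (Φ.comp (substC A'))

omit [DecidableEq ι] in
/-- `conj` unfolded (bookkeeping). [cite: Lang2002, Ch. IV §1] -/
theorem conj_apply (A A' : Matrix ι ι K) (Φ : Polynomial (MvPolynomial ι K) →+* Polynomial (MvPolynomial ι K))
    (F : Polynomial (MvPolynomial ι K)) : conj A A' Φ F = substC A (Φ (substC A' F)) := rfl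

omit [DecidableEq ι] in
/-- The conjugate fixes `K` if `Φ` does (bookkeeping; the hypothesis `hC` of the monomial-curve format). [cite: Lang2002, Ch. IV §1] -/
theorem conj_C_C (A A' : Matrix ι ι K) (Φ : Polynomial (MvPolynomial ι K) →+* Polynomial (MvPolynomial ι K))
    (hC : ∀ a : K, Φ (Polynomial.C (C a)) = Polynomial.C (C a)) (a : K) :
    conj A A' Φ (Polynomial.C (C a)) = Polynomial.C (C a) := by
  rw [conj_apply, substC_C, MvPolynomial.algHom_C, MvPolynomial.algebraMap_eq, hC, substC_C, MvPolynomial.algHom_C,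
    MvPolynomial.algebraMap_eq]

/-- **The conjugate acts on the slots in the same format** (ours, bookkeeping; the hypothesis `hX`): if `Φ (C X_j) = C X_j + Σ_t X^{e t} C (v t j)`
and `A'·A = 1`, then `conj A A' Φ (C X_j) = C X_j + Σ_t X^{e t} C (v' t j)` with the new columns `v' t j := Σ_k A'_{jk} · (v t k)∘A`.
[cite: Lang2002, Ch. IV §1, Ch. XIII §4] -/
theorem conj_C_X {τ : Type*} [Fintype τ] (A A' : Matrix ι ι K) (hA' : A' * A = 1) (e : τ → ℕ) (v : τ → ι → MvPolynomial ι K)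
    (Φ : Polynomial (MvPolynomial ι K) →+* Polynomial (MvPolynomial ι K))
    (hC : ∀ a : K, Φ (Polynomial.C (C a)) = Polynomial.C (C a))
    (hX : ∀ j, Φ (Polynomial.C (X j)) = Polynomial.C (X j) + ∑ t, Polynomial.X ^ e t * Polynomial.C (v t j)) (j : ι) :
    conj A A' Φ (Polynomial.C (X j)) = Polynomial.C (X j)
      + ∑ t, Polynomial.X ^ e t * Polynomial.C (∑ k, C (A' j k) * InvariantDirection.linSubst (fun j k => A j k) (v t k)) := by
  have h1 : ∑ k, C (A' j k) * InvariantDirection.linSubst (fun j k => A j k) (X k : MvPolynomial ι K) = X j := by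
    have h2 : InvariantDirection.linSubst (fun j k => A j k)
        (InvariantDirection.linSubst (fun j k => A' j k) (X j : MvPolynomial ι K)) = X j := by
      rw [InvariantDirection.linSubst_linSubst, hA', InvariantDirection.linSubst_one, AlgHom.coe_id, id_eq]
    conv_rhs => rw [← h2, InvariantDirection.linSubst_X, map_sum]
    refine Finset.sum_congr rfl fun k _ => ?_
    rw [map_mul, MvPolynomial.algHom_C, MvPolynomial.algebraMap_eq]
  have hL : ∀ k, substC A (Φ (Polynomial.C (C (A' j k)) * Polynomial.C (X k)))
      = Polynomial.C (C (A' j k)) * Polynomial.C (InvariantDirection.linSubst (fun j k => A j k) (X k))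
        + ∑ t, Polynomial.X ^ e t * Polynomial.C (C (A' j k) * InvariantDirection.linSubst (fun j k => A j k) (v t k)) := by
    intro k
    rw [map_mul, hC, hX, map_mul, substC_C, MvPolynomial.algHom_C, MvPolynomial.algebraMap_eq, map_add, substC_C, map_sum,
      mul_add, Finset.mul_sum, add_right_inj]
    refine Finset.sum_congr rfl fun t _ => ?_
    rw [map_mul, map_pow, substC_X, substC_C, Polynomial.C_mul]
    ring
  calc conj A A' Φ (Polynomial.C (X j))
      = substC A (Φ (∑ k, Polynomial.C (C (A' j k)) * Polynomial.C (X k))) := by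
        rw [conj_apply, substC_C, InvariantDirection.linSubst_X, map_sum]
        simp_rw [Polynomial.C_mul]
    _ = ∑ k, (Polynomial.C (C (A' j k)) * Polynomial.C (InvariantDirection.linSubst (fun j k => A j k) (X k))
          + ∑ t, Polynomial.X ^ e t
            * Polynomial.C (C (A' j k) * InvariantDirection.linSubst (fun j k => A j k) (v t k))) := by
        rw [map_sum, map_sum]
        exact Finset.sum_congr rfl fun k _ => hL k
    _ = Polynomial.C (∑ k, C (A' j k) * InvariantDirection.linSubst (fun j k => A j k) (X k))
          + ∑ t, Polynomial.X ^ e t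
            * Polynomial.C (∑ k, C (A' j k) * InvariantDirection.linSubst (fun j k => A j k) (v t k)) := by
        rw [Finset.sum_add_distrib]
        simp_rw [map_sum, Polynomial.C_mul, Finset.mul_sum]
        rw [Finset.sum_comm]
    _ = _ := by rw [h1]

/-- **… and fixes `C (G∘A)`** (ours, bookkeeping; the hypothesis `hΦ`): if `Φ (C G) = C G` and `A·A' = 1` then
`conj A A' Φ (C (G∘A)) = C (G∘A)`. [cite: Lang2002, Ch. IV §1] -/
theorem conj_C_linSubst (A A' : Matrix ι ι K) (hA : A * A' = 1) (Φ : Polynomial (MvPolynomial ι K) →+* Polynomial (MvPolynomial ι K))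
    {G : MvPolynomial ι K} (hΦ : Φ (Polynomial.C G) = Polynomial.C G) :
    conj A A' Φ (Polynomial.C (InvariantDirection.linSubst (fun j k => A j k) G))
      = Polynomial.C (InvariantDirection.linSubst (fun j k => A j k) G) := by
  rw [conj_apply, substC_C, InvariantDirection.linSubst_linSubst, hA, InvariantDirection.linSubst_one, AlgHom.coe_id, id_eq, hΦ,
    substC_C]

/-- **Rank-one columns become a coordinate column** (ours, bookkeeping; the hypothesis `hvi` of `RZEndgame.eq_zero_of_isotropy`): if
`v k = θ_k · α` for all `k`, `A e_i = θ`, `A'·A = 1` and `α∘A = α`, then the transported column `Σ_k A'_{jk} (v k)∘A` is `δ_{ji} · α`.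
[cite: Lang2002, Ch. XIII §4] -/
theorem column_eq_ite_of_rank_one (A A' : Matrix ι ι K) (hA' : A' * A = 1) {i : ι} {θ : ι → K} (hcol : ∀ r, A r i = θ r)
    {α : MvPolynomial ι K} (hα : InvariantDirection.linSubst (fun j k => A j k) α = α) {v : ι → MvPolynomial ι K}
    (hv : ∀ k, v k = θ k • α) (j : ι) :
    ∑ k, C (A' j k) * InvariantDirection.linSubst (fun j k => A j k) (v k) = if j = i then α else 0 := by
  have key : ∑ k, C (A' j k) * InvariantDirection.linSubst (fun j k => A j k) (v k) = C ((A' * A) j i) * α := by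
    rw [Matrix.mul_apply, map_sum, Finset.sum_mul]
    refine Finset.sum_congr rfl fun k _ => ?_
    rw [hv k, map_smul, hα, hcol k, smul_eq_C_mul, map_mul]
    ring
  rw [key, hA', Matrix.one_apply]
  split_ifs <;> simp

/-! ## Weights under a class-linear substitution -/

section Weights

variable {M : Type*} [AddCommMonoid M]

/-- A monomial of `P∘A`, `A` class-linear on a class where the weight `zw` is constant, has the weight of a monomial of `P` (ours,
bookkeeping). [cite: AbramovichTemkinWlodarczyk2024, §5.1 (p. 1575)] -/
theorem exists_weight_eq_of_mem_support_linSubst {zw : ι → M} {S : Finset ι} {A : Matrix ι ι K}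
    (hA : InvariantDirection.IsClassLinear S A) (hS : ∀ j ∈ S, ∀ k ∈ S, zw j = zw k) (P : MvPolynomial ι K) {m : ι →₀ ℕ}
    (hm : m ∈ (InvariantDirection.linSubst (fun j k => A j k) P).support) :
    ∃ m' ∈ P.support, Finsupp.weight zw m' = Finsupp.weight zw m := by
  classical
  rw [P.as_sum, map_sum] at hm
  obtain ⟨m', hm', hmm'⟩ := Finset.mem_biUnion.mp (support_sum hm)
  refine ⟨m', hm', ?_⟩
  exact ((hA.isWeightedHomogeneous_linSubst hS (isWeightedHomogeneous_monomial zw m' (coeff m' P) rfl)) (mem_support_iff.mp hmm')).symm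

/-- **The weight bounds survive** (ours, bookkeeping; the hypotheses `hv0/hv1`): with `A, A'` class-linear on a class `S` where `zw` is
constant, if every monomial of `v k` weighs `≥ zw k + d` then every monomial of the transported column `Σ_k A'_{jk} (v k)∘A` weighs
`≥ zw j + d`. [cite: AbramovichTemkinWlodarczyk2024, §5.1 (p. 1575)] -/
theorem le_weight_of_mem_support_column [PartialOrder M] {zw : ι → M} {S : Finset ι} {A A' : Matrix ι ι K}
    (hA : InvariantDirection.IsClassLinear S A) (hA' : InvariantDirection.IsClassLinear S A')
    (hS : ∀ j ∈ S, ∀ k ∈ S, zw j = zw k) {d : M} (v : ι → MvPolynomial ι K)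
    (hv : ∀ k, ∀ m ∈ (v k).support, zw k + d ≤ Finsupp.weight zw m) (j : ι) {m : ι →₀ ℕ}
    (hm : m ∈ (∑ k, C (A' j k) * InvariantDirection.linSubst (fun j k => A j k) (v k)).support) :
    zw j + d ≤ Finsupp.weight zw m := by
  classical
  obtain ⟨k, -, hk⟩ := Finset.mem_biUnion.mp (support_sum hm)
  have hjk : A' j k ≠ 0 := by
    intro h0
    rw [h0, C_0, zero_mul] at hk
    simp at hk
  have hk' : m ∈ (InvariantDirection.linSubst (fun j k => A j k) (v k)).support := by
    rw [← smul_eq_C_mul] at hk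
    exact support_smul hk
  obtain ⟨m', hm', hw⟩ := exists_weight_eq_of_mem_support_linSubst hA hS (v k) hk'
  have hzw : zw j = zw k := by
    by_cases hj : j ∈ S
    · by_cases hkS : k ∈ S
      · exact hS j hj k hkS
      · exfalso
        exact hjk (by rw [hA' j k (Or.inr hkS), Matrix.one_apply_ne fun h : j = k => hkS (h ▸ hj)])
    · by_cases hjk' : j = k
      · rw [hjk']
      · exfalso
        exact hjk (by rw [hA' j k (Or.inl hj), Matrix.one_apply_ne hjk'])
  rw [hzw, ← hw]
  exact hv k m' hm'

/-- **`(G∘A)‾ = Ḡ∘A`**: a class-linear substitution on a class of constant weight commutes with taking weighted homogeneous components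
(ours, bookkeeping). [cite: AbramovichTemkinWlodarczyk2024, §5.1 (p. 1575)] -/
theorem weightedHomogeneousComponent_linSubst {zw : ι → M} {S : Finset ι} {A : Matrix ι ι K}
    (hA : InvariantDirection.IsClassLinear S A) (hS : ∀ j ∈ S, ∀ k ∈ S, zw j = zw k) (G : MvPolynomial ι K) (n : M) :
    weightedHomogeneousComponent zw n (InvariantDirection.linSubst (fun j k => A j k) G)
      = InvariantDirection.linSubst (fun j k => A j k) (weightedHomogeneousComponent zw n G) := by
  classical
  conv_lhs => rw [G.as_sum, map_sum, map_sum]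
  rw [weightedHomogeneousComponent_apply, map_sum, Finset.sum_filter]
  refine Finset.sum_congr rfl fun m _ => ?_
  have hT : IsWeightedHomogeneous zw (InvariantDirection.linSubst (fun j k => A j k) (monomial m (coeff m G)))
      (Finsupp.weight zw m) :=
    hA.isWeightedHomogeneous_linSubst hS (isWeightedHomogeneous_monomial zw m (coeff m G) rfl)
  split_ifs with h
  · rw [← h]
    exact hT.weightedHomogeneousComponent_same
  · exact hT.weightedHomogeneousComponent_ne n fun h' => h h'.symm

end Weights

/-- **`Z`-forms are fixed**: a polynomial involving no variable of the class `S` is fixed by every class-linear substitution on `S`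
(ours, bookkeeping). [cite: Lang2002, Ch. XIII §4] -/
theorem linSubst_eq_self_of_forall_notMem {S : Finset ι} {A : Matrix ι ι K} (hA : InvariantDirection.IsClassLinear S A)
    {P : MvPolynomial ι K} (hP : ∀ i ∈ P.vars, i ∉ S) : InvariantDirection.linSubst (fun j k => A j k) P = P := by
  classical
  have hX : ∀ i ∈ P.vars, InvariantDirection.linSubst (fun j k => A j k) (X i : MvPolynomial ι K) = X i := by
    intro i hi
    rw [InvariantDirection.linSubst_X, Finset.sum_eq_single i (fun k _ hk => ?_) (fun h => absurd (Finset.mem_univ i) h),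
      hA i i (Or.inl (hP i hi)), Matrix.one_apply_eq, C_1, one_mul]
    rw [hA i k (Or.inl (hP i hi)), Matrix.one_apply_ne (Ne.symm hk), C_0, zero_mul]
  change (InvariantDirection.linSubst (fun j k => A j k) : MvPolynomial ι K →ₐ[K] MvPolynomial ι K).toRingHom P = RingHom.id _ P
  refine hom_congr_vars ?_ (fun i hi _ => ?_) rfl
  · ext c
    simp
  · exact hX i hi

/-! ## The normal form `G = X_i^p · C c + R`, `deg_{X_i} R < p`, from the weights -/

omit [Fintype ι] in
/-- **Normal form from the weights** (ours, bookkeeping; the hypotheses `hG/hR` of `RZEndgame.eq_zero_of_isotropy`): if `G` is weighted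
homogeneous of weight `μ = p·w_i` for positive rational weights and `0 < p`, then `G = X_i^p · C c + R` with `c = [x_i^p] G` and
`deg_{X_i} R < p` — a monomial of weight `μ` containing `X_i^p` is `X_i^p` itself. [cite: AbramovichTemkinWlodarczyk2024, §5.1 (p. 1575)] -/
theorem eq_X_pow_mul_C_add {w : ι → ℚ} (hw : ∀ j, 0 < w j) {μ : ℚ} {G : MvPolynomial ι K} (hG : IsWeightedHomogeneous w G μ)
    {p : ℕ} (hp : 0 < p) {i : ι} (hi : (p : ℚ) * w i = μ) :
    G = X i ^ p * C (coeff (Finsupp.single i p) G) + (G - X i ^ p * C (coeff (Finsupp.single i p) G)) ∧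
      degreeOf i (G - X i ^ p * C (coeff (Finsupp.single i p) G)) < p := by
  classical
  refine ⟨(add_sub_cancel _ _).symm, (degreeOf_lt_iff hp).mpr fun m hm => ?_⟩
  rw [mem_support_iff, coeff_sub, X_pow_eq_monomial, mul_comm, C_mul_monomial, mul_one, coeff_monomial] at hm
  by_cases hmi : m = Finsupp.single i p
  · rw [hmi, if_pos rfl, sub_self] at hm
    exact absurd rfl hm
  rw [if_neg (Ne.symm hmi), sub_zero] at hm
  -- `m ≠ p e_i` is a monomial of `G`: weight count
  have hwm : Finsupp.weight w m = μ := hG hm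
  by_contra hle
  push Not at hle
  -- `m i ≥ p`: then `μ = Σ m_k w_k ≥ m_i w_i ≥ p w_i = μ` forces `m = p e_i`
  apply hmi
  rw [Finsupp.weight_apply, Finsupp.sum] at hwm
  have hi_mem : i ∈ m.support := Finsupp.mem_support_iff.mpr (by omega)
  have hsplit := Finset.add_sum_erase m.support (fun k => m k • w k) hi_mem
  rw [hwm] at hsplit
  -- hsplit : m i • w i + Σ_{k ≠ i} m k • w k = μ
  have hrest_nonneg : 0 ≤ ∑ k ∈ m.support.erase i, m k • w k :=
    Finset.sum_nonneg fun k _ => nsmul_nonneg (hw k).le _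
  have hmi_le : (m i : ℚ) * w i ≤ (p : ℚ) * w i := by
    rw [nsmul_eq_mul] at hsplit
    linarith
  have hmi_eq : m i = p := by
    have := le_of_mul_le_mul_right hmi_le (hw i)
    exact le_antisymm (by exact_mod_cast this) hle
  have hrest : ∑ k ∈ m.support.erase i, m k • w k = 0 := by
    rw [nsmul_eq_mul, hmi_eq] at hsplit
    linarith
  have hzero : ∀ k ∈ m.support.erase i, m k • w k = 0 :=
    (Finset.sum_eq_zero_iff_of_nonneg fun k _ => nsmul_nonneg (hw k).le _).mp hrest
  ext k
  by_cases hki : k = i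
  · rw [hki, Finsupp.single_eq_same, hmi_eq]
  · rw [Finsupp.single_apply, if_neg (Ne.symm hki)]
    by_contra hk0
    have hk : k ∈ m.support.erase i := Finset.mem_erase.mpr ⟨hki, Finsupp.mem_support_iff.mpr hk0⟩
    have h := hzero k hk
    rw [nsmul_eq_mul, mul_eq_zero] at h
    rcases h with h | h
    · exact hk0 (by exact_mod_cast h)
    · exact (hw k).ne' h

end RZTransport

end Literature.AlgebraicGeometry.Resolution.WeightedBlowup
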